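import Literature.Computability.AlgebraicComplexity.ConstantFreeCircuits
import Literature.Computability.AlgebraicComplexity.BurgisserBooleanPartsA3Steps
import Literature.Barriers.ValiantsHypothesis.CT23ProjCircuitBaseChange
import HarnessLib

/-!
# AnyonJets — crux `JetConstantElim` (stmt-ValiantsHypothesis-16737), line `birth`:
# stub `stub_signSimulation` (bounded-height integer constants are eliminable at polynomial cost)

Route `ValiantsHypothesis/AnyonJets`, crux `JetConstantElim`, registered line
`Cruxes/JetConstantElim/Lines/birth.lean`. This file proves the line's third ("known") stub, verbatim:

* `stub_signSimulation` — there is `b₂` such that an integer fan-in-two circuit `P` computing `f`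
  all of whose constants and sum coefficients have absolute value `≤ 2^t` yields
  `τ(f) ≤ (P.size + t + 2)^{b₂}` (here `b₂ = 5`).

Proof (Bürgisser 2000, §1.4; Malod 2003, "calculs sans constantes"): by Bürgisser's integer
SKELETON (tree `Literature.Computability.AlgebraicComplexity.skeleton`, `aeval_slotSubst_skeleton`:
every sum coefficient and constant operand of `P` becomes a fresh slot variable, giving a
constant-free fan-in-two circuit of size `3·|P|` in the variables of `P` and `4|P| + 1` slots whose
value specialises back to `P.eval` at the slot constants), `f = F(x, y)` with `τ(F) ≤ 3|P|`; the slot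
constants `y_v` are constants / coefficients of `P` or `0`, so `|y_v| ≤ 2^t` and
`τ(y_v) ≤ 3(t+1) + 1` (binary Horner, tree `constantFreeComplexity_C_natCast_le_log`); substituting
them costs `τ(F(x, y)) ≤ τ(F) + Σ_v τ(y_v)` (`constantFreeComplexity_aeval_sumElim_le`, the partial
form of the tree's substitution bound `constantFreeComplexity_aeval_le`, needed because the variable
type `σ` of the stub is arbitrary), whence `τ(f) ≤ 3|P| + (4|P|+1)(3t+4) ≤ (|P| + t + 2)^5`.

Honest framing: a bookkeeping stub; the load-bearing stubs of the line (`stub_integralMultiple`,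
`stub_multiplierRemoval`) and the crux stay open; VP ≠ VNP is NOT proved here.
-/

noncomputable section

open MvPolynomial

-- the summit and the problem share the name `ValiantsHypothesis` (D-0017 single-conjunct layout)
set_option linter.dupNamespace false

namespace Summit.ValiantsHypothesis.ValiantsHypothesis.Theorems.AnyonJets.JetConstantElim

open Literature.Computability.AlgebraicComplexity
open Literature.Computability.AlgebraicComplexity.ArithCircuit

/-! ### Partial substitution bound for `τ` -/

/-- **Partial substitution bound for `τ`**: substituting constant-free-cheap polynomials `g_j` for
the second block of variables costs at most their complexities:
`τ(F(x, g)) ≤ τ(F) + Σ_j τ(g_j)` (juxtapose minimal circuits for the `g_j` and plug their outputs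
into the slot inputs of a minimal circuit for `F`; the `x`-inputs stay inputs). The tree's
`constantFreeComplexity_aeval_le` is the case where ALL variables are substituted and needs a finite
variable type; here the kept block `σ` is arbitrary. [cite: Burgisser2000, Rem. 2.7] -/
theorem constantFreeComplexity_aeval_sumElim_le {σ : Type*} {m : ℕ}
    (F : MvPolynomial (σ ⊕ Fin m) ℤ) (g : Fin m → MvPolynomial σ ℤ) :
    constantFreeComplexity (aeval (Sum.elim X g) F) ≤
      constantFreeComplexity F + ∑ j, constantFreeComplexity (g j) := by
  classical
  obtain ⟨P, hP1, hP2, hP3, hP4⟩ := exists_computes_size_eq_constantFreeComplexity F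
  choose Q hQ1 hQ2 hQ3 hQ4 using fun j => exists_computes_size_eq_constantFreeComplexity (g j)
  set L : List (ArithCircuit ℤ σ) := List.ofFn fun j : Fin m => Q j with hL
  have hLlen : L.length = m := by simp [hL]
  have hmemL : ∀ R ∈ L, ∃ j, R = Q j := fun R hR => by
    simp only [hL, List.mem_ofFn] at hR
    obtain ⟨j, rfl⟩ := hR
    exact ⟨_, rfl⟩
  set ρ : σ ⊕ Fin m → Operand ℤ σ :=
    Sum.elim (fun i => Operand.var i) fun j => (juxtOuts L)[(j : ℕ)]'(by simp [hLlen]) with hρ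
  have hρeval : ∀ i ws, (ρ i).eval (gateValues (juxtGates L) ++ ws) = Sum.elim X g i := by
    rintro (i | j) ws
    · rfl
    · have hj : ((j : ℕ)) < L.length := by simp [hLlen]
      have h := eval_juxtOuts L j hj ws
      simp only [hρ, Sum.elim_inr]
      rw [h]
      have : L[(j : ℕ)]'hj = Q j := by simp [hL, List.getElem_ofFn]
      rw [this]
      exact hQ3 j
  have hcomp : (P.substCircuit (juxtGates L) ρ).Computes (aeval (Sum.elim X g) F) := by
    rw [Computes] at hP3 ⊢
    rw [eval_substCircuit P (juxtGates L) hρeval, hP3]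
  have hfan : (P.substCircuit (juxtGates L) ρ).IsFanInTwo :=
    hP1.substCircuit (fanIn_juxtGates fun R hR => by
      obtain ⟨j, rfl⟩ := hmemL R hR; exact hQ1 j) ρ
  have hρsign : ∀ i, (ρ i).HasSignConstants := by
    rintro (i | j)
    · exact Operand.hasSignConstants_var i
    · exact hasSignConstants_juxtOuts (fun R hR => by obtain ⟨j, rfl⟩ := hmemL R hR; exact hQ2 j) _
        (List.getElem_mem _)
  have hsign : (P.substCircuit (juxtGates L) ρ).HasSignConstants :=
    hP2.substCircuit (hasSignConstants_juxtGates fun R hR => by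
      obtain ⟨j, rfl⟩ := hmemL R hR; exact hQ2 j) hρsign
  refine (constantFreeComplexity_le_size hfan hsign hcomp).trans (le_of_eq ?_)
  rw [size_substCircuit, length_juxtGates, hP4, add_comm]
  congr 1
  rw [hL, List.map_ofFn, List.sum_ofFn]
  simp only [Function.comp_def, hQ4]

/-! ### The slot constants of a circuit with bounded constants -/

/-- `τ(c) ≤ 3(t + 1) + 1` for an integer `c` with `|c| ≤ 2^t` (binary Horner for `|c|`, tree
`constantFreeComplexity_C_natCast_le_log`, and one negation). [cite: Burgisser2009, §2.2] -/
theorem constantFreeComplexity_C_le_of_natAbs_le {σ : Type*} {c : ℤ} {t : ℕ}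
    (hc : c.natAbs ≤ 2 ^ t) :
    constantFreeComplexity (C c : MvPolynomial σ ℤ) ≤ 3 * (t + 1) + 1 := by
  have hlog : Nat.log 2 c.natAbs ≤ t := by
    rcases Nat.eq_zero_or_pos c.natAbs with h0 | hpos
    · rw [h0, Nat.log_zero_right]; exact Nat.zero_le _
    · exact (Nat.log_mono_right hc).trans (by rw [Nat.log_pow one_lt_two])
  have habs : constantFreeComplexity (C (c.natAbs : ℤ) : MvPolynomial σ ℤ) ≤ 3 * (t + 1) :=
    (Literature.Barriers.ValiantsHypothesis.constantFreeComplexity_C_natCast_le_log c.natAbs).trans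
      (by omega)
  rcases Int.natAbs_eq c with h | h
  · rw [← h] at habs; omega
  · have hneg : (C c : MvPolynomial σ ℤ) = -C (c.natAbs : ℤ) := by
      rw [← map_neg, ← h]
    rw [hneg]
    exact (constantFreeComplexity_neg_le _).trans (by omega)

/-- Under the three height hypotheses of the stub, every slot constant of `P` (a sum coefficient,
a constant operand, the output constant, or `0`) has absolute value `≤ 2^t`. [folklore] -/
theorem natAbs_slotConst_le {σ : Type*} (P : ArithCircuit ℤ σ) (t : ℕ)
    (h1 : ∀ g ∈ P.gates, ∀ u ∈ g.args, ∀ c : ℤ, u = .const c → c.natAbs ≤ 2 ^ t)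
    (h2 : ∀ args : List (ℤ × Operand ℤ σ), Gate.sum args ∈ P.gates → ∀ a ∈ args, a.1.natAbs ≤ 2 ^ t)
    (h3 : ∀ c : ℤ, P.output = .const c → c.natAbs ≤ 2 ^ t) (i : ℕ) :
    (slotConst P i).natAbs ≤ 2 ^ t := by
  have h0 : (0 : ℤ).natAbs ≤ 2 ^ t := by simp
  -- the constant of an operand occurring in `P`
  have hop : ∀ u : Operand ℤ σ, (∀ c : ℤ, u = .const c → c.natAbs ≤ 2 ^ t) →
      (operandConst u).natAbs ≤ 2 ^ t := by
    intro u hu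
    cases u with
    | var i => exact h0
    | const c => exact hu c rfl
    | gate j => exact h0
  unfold slotConst
  split
  · exact hop _ h3
  · split
    · exact h0
    · next args hg =>
      split
      · exact h0
      · next a ha =>
        split
        · exact h2 args (List.mem_of_getElem? hg) a (List.mem_of_getElem? ha)
        · exact hop _ fun c hc => h1 _ (List.mem_of_getElem? hg) a.2
            (by simp only [Gate.args, List.mem_map]; exact ⟨a, List.mem_of_getElem? ha, rfl⟩) c hc
    · next args hg =>
      split
      · exact h0
      · next u hu =>
        split
        · exact h0
        · exact hop _ fun c hc => h1 _ (List.mem_of_getElem? hg) u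
            (by simpa [Gate.args] using List.mem_of_getElem? hu) c hc

/-! ### The stub -/

/-- Envelope arithmetic: `3 s + (4 s + 1)(3 (t+1) + 1) ≤ (s + t + 2)^5`. [folklore] -/
theorem envelope_le (s t : ℕ) : 3 * s + (4 * s + 1) * (3 * (t + 1) + 1) ≤ (s + t + 2) ^ 5 := by
  rcases Nat.lt_or_ge (s + t + 2) 3 with h | h
  · have hs : s = 0 := by omega
    have ht : t = 0 := by omega
    subst hs; subst ht; norm_num
  · set u := s + t + 2 with hu
    have h1 : 3 * s + (4 * s + 1) * (3 * (t + 1) + 1) ≤ 16 * (u * u) := by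
      rw [hu]; nlinarith [Nat.zero_le (s * t), Nat.zero_le (s * s), Nat.zero_le (t * t)]
    have h2 : 16 * (u * u) ≤ u ^ 5 := by
      have h3 : 16 ≤ u ^ 3 := le_trans (by norm_num) (Nat.pow_le_pow_left h 3)
      calc 16 * (u * u) ≤ u ^ 3 * (u * u) := Nat.mul_le_mul_right _ h3
        _ = u ^ 5 := by ring
    exact h1.trans h2

/-- **Stub `SignSimulation`** (registered obligation `stub_signSimulation` of crux
`JetConstantElim`, line `birth`; signature verbatim): an integer fan-in-two circuit `P` computing `f`
with all constant operands, sum coefficients and the output constant of absolute value `≤ 2^t`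
gives `τ(f) ≤ (|P| + t + 2)^5` — via Bürgisser's integer skeleton of `P` (constants ↦ slot
variables, a constant-free circuit of size `3|P|`) and re-substitution of the `4|P|+1` slot
constants by their binary Horner circuits. [cite: Burgisser2000, §1.4] -/
theorem stub_signSimulation :
    ∃ b₂ : ℕ, ∀ (σ : Type) (f : MvPolynomial σ ℤ)
      (P : Literature.Computability.AlgebraicComplexity.ArithCircuit ℤ σ) (t : ℕ),
      P.IsFanInTwo → P.Computes f →
      ((∀ g ∈ P.gates, ∀ u ∈ g.args, ∀ c : ℤ, u = .const c → c.natAbs ≤ 2 ^ t) ∧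
        (∀ args : List (ℤ × Literature.Computability.AlgebraicComplexity.ArithCircuit.Operand ℤ σ),
          Literature.Computability.AlgebraicComplexity.ArithCircuit.Gate.sum args ∈ P.gates →
            ∀ a ∈ args, a.1.natAbs ≤ 2 ^ t) ∧
        (∀ c : ℤ, P.output = .const c → c.natAbs ≤ 2 ^ t)) →
      Literature.Computability.AlgebraicComplexity.constantFreeComplexity f ≤ (P.size + t + 2) ^ b₂ := by
  refine ⟨5, fun σ f P t hP2 hPf ⟨h1, h2, h3⟩ => ?_⟩
  -- `f = F(x, y)` for the skeleton `F` and the slot constants `y`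
  have hf : f = aeval (Sum.elim X fun v : Fin (4 * P.size + 1) => C (slotConst P v))
      (skeleton P).eval := by
    rw [← hPf]
    exact (aeval_slotSubst_skeleton P hP2).symm
  -- `τ(F) ≤ 3 |P|`
  have hF : constantFreeComplexity (skeleton P).eval ≤ 3 * P.size := by
    rw [← size_skeleton P]
    exact constantFreeComplexity_le_size (isFanInTwo_skeleton P) (hasSignConstants_skeleton P) rfl
  -- the slot constants are cheap
  have hy : ∀ v : Fin (4 * P.size + 1),
      constantFreeComplexity (C (slotConst P v) : MvPolynomial σ ℤ) ≤ 3 * (t + 1) + 1 := fun v =>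
    constantFreeComplexity_C_le_of_natAbs_le (natAbs_slotConst_le P t h1 h2 h3 v)
  calc constantFreeComplexity f
      ≤ constantFreeComplexity (skeleton P).eval +
          ∑ v : Fin (4 * P.size + 1), constantFreeComplexity (C (slotConst P v) : MvPolynomial σ ℤ) := by
        rw [hf]; exact constantFreeComplexity_aeval_sumElim_le _ _
    _ ≤ 3 * P.size + ∑ _v : Fin (4 * P.size + 1), (3 * (t + 1) + 1) :=
        Nat.add_le_add hF (Finset.sum_le_sum fun v _ => hy v)
    _ = 3 * P.size + (4 * P.size + 1) * (3 * (t + 1) + 1) := by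
        rw [Finset.sum_const, Finset.card_univ, Fintype.card_fin, smul_eq_mul]
    _ ≤ (P.size + t + 2) ^ 5 := envelope_le P.size t

end Summit.ValiantsHypothesis.ValiantsHypothesis.Theorems.AnyonJets.JetConstantElim

end
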